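import Literature.MathematicalPhysics.QuantumFieldTheory.Balaban1983to89.B13CoerciveOfInverseFormBound
import Literature.MathematicalPhysics.QuantumFieldTheory.Balaban1983to89.B9Thm311QuantAtLettersY

/-!
# `Balaban1983to89.B13CoerciveIffPosDefInverseBound` — T. Bałaban, *Propagators for lattice gauge theories in a background field*, Commun. Math. Phys. **99** (1985)
# 389–434 [Balaban1985BackgroundPropagators], (3.26)–(3.27) p. 395, (3.46)–(3.47) p. 398, Thm 3.3 p. 399, Thm 3.11 p. 416; [4] = *Propagators … II*, Commun. Math. Phys.
# **96** (1984) 223–250 [Balaban1984PropagatorsII] p. 226 («the operator Δ_a is bounded from below by a positive constant, hence … G = Δ_a⁻¹»):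
# ★ «QUANTITATIVE COERCIVITY» ≡ «THEOREM 3.11's CLAUSE ∧ THEOREM 3.3's L²-FORM BOUND FOR THE INVERSE», WITH RECIPROCAL CONSTANTS — the two directions of the
# interface between the N10 lane's v4 road and N06's bond-sector theorems, stated as one equivalence (module 82 = «⟸» with `m = B⁻¹`; the tree's
# `B9Thm311QuantAtLettersY.inverse_bounds_of_coercive` = «⟹» with `B = m⁻¹`).

[folklore] form algebra BY NAME over module 82 and the N06 lineage's `B9Thm311QuantAtLettersY`; THEOREMS ONLY; nothing of NODE 00's ∕ N06's is modified or restated;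
nothing here is a claim about the Yang–Mills mass gap; no node is discharged; count-neutral.

WHY THIS FILE (cell `pub-ymgap`, HUMAN RULING D-0062, Track A node N10 = [B13]; seat `pub-ymgap-dag-n10-c` g16, module 85).  The lane's census v21 records the
interface for print's last inverse `G = Δ_a⁻¹` as «quantitative coercivity `hco` ≡ Thm 3.11's clause ∧ Thm 3.3's global L²-form bound for `G`, reciprocal
constants»; module 82 typed one direction.  This file states the EQUIVALENCE as a theorem, so the census sentence is kernel-checked in both directions: at a
trIP-symmetric operator `T` (print's Δ_a(U₀) at a `G`-valued background), `(∃ m > 0, m⟨Ψ,Ψ⟩_w ≤ ⟨Ψ,TΨ⟩_w) ↔ (PosDefTr w T ∧ ∃ B > 0, ⟨Φ,T⁻¹Φ⟩_w ≤ B⟨Φ,Φ⟩_w)`, with the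
located passages `m ↦ B := m⁻¹` and `B ↦ m := B⁻¹`.

WHAT THIS FILE PROVES (all `theorem`s).
* §1 (ANY finite `S, n`, positive weight `w`) `posDefTr_of_coer` (coercive with `0 < m` ⟹ `PosDefTr w`), ★ `ringInverse_formBound_of_coer` (trIP-symmetric, `m`-coercive,
  `0 < m` ⟹ `⟨Φ, T⁻¹Φ⟩_w ≤ m⁻¹·⟨Φ,Φ⟩_w` — `inverse_bounds_of_coercive` at `Ti := Ring.inverse T`), ★ `coer_iff_posDefTr_and_ringInverse_formBound` (the equivalence).
* §2 (NODE 00's bond sector at def-Y's v4 letters, `G ≤ U(N)`, `G`-valued `U₀`) ★★ `trIP_deltaAY_parSymY_coer_iff_posDefTr_and_GAY_formBound`: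
  `(∃ m > 0, ∀ Ψ, m⟨Ψ,Ψ⟩₁ ≤ ⟨Ψ, Δ_a(U₀)Ψ⟩₁) ↔ (PosDefTr 1 (Δ_a(U₀)) ∧ ∃ B > 0, ∀ Φ, ⟨Φ, G(U₀)Φ⟩₁ ≤ B⟨Φ,Φ⟩₁)` — symmetry by n06-j's `deltaAY_parSymY_isSymmTr`;
  `GAY_parSymY_formBound_of_coer` (the located «⟹»: `B = m⁻¹`).
HONEST FRAMING: [folklore] bookkeeping; neither side of the equivalence is PROVED here for Bałaban's `Δ_a` on (3.35) — both are N06's (Thms 3.3 ∕ 3.11); nothing of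
Bałaban's asserted; N06 ∕ N10 NOT discharged; K1⁹ NOT closed; counts unmoved (typed 28∕28 · discharged 5∕27); 0 `def`, 0 `sorry`, standard axioms; one finite 𝕋⁴
programme at fixed ε — R4 closes the conditional finite-𝕋⁴ rung `BalabanLadder.UV` only; the YM mass gap (Clay) is NOT proved by any of this; nothing continuum ∕ ℝ⁴ ∕ OS.
Filed `--kind proof --supports` K1⁹ (stmt-QuantumFields-27364), Literature lane.

References: T. Bałaban, CMP 99 (1985) 389–434 [Balaban1985BackgroundPropagators] (3.26)–(3.27) p.395, (3.46)–(3.47) p.398, Thm 3.3 p.399, Thm 3.11 p.416; CMP 96 (1984)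
223–250 [Balaban1984PropagatorsII] p.226; CMP 116 (1988) 1–22 [Balaban1988RG2Cluster] (2.5)–(2.7) pp.12–13, p.15.
-/

noncomputable section

namespace Literature.MathematicalPhysics.QuantumFieldTheory.Balaban1983to89.B13CoerciveIffPosDefInverseBound

open scoped Matrix Matrix.Norms.L2Operator
open Literature.MathematicalPhysics.QuantumFieldTheory.Balaban1983to89
open Literature.MathematicalPhysics.QuantumFieldTheory.Balaban1983to89.B9Thm311ReadingCoords
  (trIP PosDefTr IsSymmTr norm_sq_realify311 realify311 isUnit_of_posDefTr apply_inverse_of_isUnit)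
open Literature.MathematicalPhysics.QuantumFieldTheory.Balaban1983to89.B13CoerciveOfInverseFormBound
  (trIP_comm coer_of_isSymmTr_posDefTr_of_ringInverse_formBound)
open Literature.MathematicalPhysics.QuantumFieldTheory.Balaban1983to89.B9Thm311QuantAtLettersY (inverse_bounds_of_coercive)
open Literature.MathematicalPhysics.QuantumFieldTheory.Balaban1983to89.B9Thm311PosViaLocalInversesY (deltaAY_parSymY_isSymmTr)
open Literature.MathematicalPhysics.QuantumFieldTheory.Balaban1983to89.B6KLevelCensusIndexV1 (KIdx)
open Literature.MathematicalPhysics.QuantumFieldTheory.Balaban1983to89.Node00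

/-! ## §1. The equivalence in print's weighted trace currency -/

section Trace

variable {S n : Type} [Fintype S] [Fintype n] {w : S → ℝ} (hw : ∀ s, 0 < w s)

include hw in
/-- a coercive operator with a positive constant is positive definite: `Φ ≠ 0 ⟹ 0 < m·⟨Φ,Φ⟩_w ≤ ⟨Φ,TΦ⟩_w` (any positive weight; the flat case is module 83's
`posDefTr_one_of_coer`). [cite: Balaban1985BackgroundPropagators, Thm 3.11 p.416; Balaban1984PropagatorsII, p.226; folklore] -/
theorem posDefTr_of_coer {T : Module.End ℂ (S → Matrix n n ℂ)} {m : ℝ} (hm : 0 < m)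
    (hco : ∀ Ψ : S → Matrix n n ℂ, m * trIP w Ψ Ψ ≤ trIP w Ψ (T Ψ)) : PosDefTr w T := by
  intro Φ hΦ
  have hpos : 0 < trIP w Φ Φ := by
    rw [← norm_sq_realify311 (w := w) (hw := hw)]
    have hne : realify311 w hw Φ ≠ 0 := fun h0 => hΦ ((LinearEquiv.map_eq_zero_iff _).mp h0)
    positivity
  exact lt_of_lt_of_le (mul_pos hm hpos) (hco Φ)

include hw in
/-- ★ **THE INVERSE's FORM BOUND FROM COERCIVITY** (located «⟹», `B = m⁻¹`): `m`-coercive with `0 < m` ⟹ `⟨Φ, T⁻¹Φ⟩_w ≤ m⁻¹·⟨Φ,Φ⟩_w` for the two-sided inverse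
`Ring.inverse T` (a unit by `posDefTr_of_coer` + `isUnit_of_posDefTr`; the bound is the N06 lineage's `inverse_bounds_of_coercive`, third clause, read through `trIP_comm`).
[cite: Balaban1985BackgroundPropagators, Thm 3.11 p.416, (3.27) p.395, (3.46)–(3.47) p.398; Balaban1984PropagatorsII, p.226; folklore] -/
theorem ringInverse_formBound_of_coer {T : Module.End ℂ (S → Matrix n n ℂ)} {m : ℝ} (hm : 0 < m)
    (hco : ∀ Ψ : S → Matrix n n ℂ, m * trIP w Ψ Ψ ≤ trIP w Ψ (T Ψ)) (Φ : S → Matrix n n ℂ) :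
    trIP w Φ (Ring.inverse T Φ) ≤ m⁻¹ * trIP w Φ Φ := by
  have hU : IsUnit T := isUnit_of_posDefTr (posDefTr_of_coer hw hm hco)
  have h := (inverse_bounds_of_coercive hw (T := T) (Ti := Ring.inverse T) hm hco (apply_inverse_of_isUnit hU) Φ).2.2
  rwa [trIP_comm w (Ring.inverse T Φ) Φ] at h

include hw in
/-- ★ **«QUANTITATIVE COERCIVITY» ≡ «POSITIVE DEFINITE ∧ THE INVERSE HAS A FORM BOUND»** for a trIP-symmetric operator (print's Δ_a(U₀): Theorem 3.11's clause
and Theorem 3.3's global L² bound for `G = Δ_a⁻¹`), with reciprocal constants: «⟹» `B := m⁻¹` (§1), «⟸» `m := B⁻¹` (module 82's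
`coer_of_isSymmTr_posDefTr_of_ringInverse_formBound`). [cite: Balaban1985BackgroundPropagators, Thm 3.11 p.416, Thm 3.3 p.399, (3.46)–(3.47) p.398; Balaban1984PropagatorsII, p.226; folklore] -/
theorem coer_iff_posDefTr_and_ringInverse_formBound {T : Module.End ℂ (S → Matrix n n ℂ)} (hsym : IsSymmTr w T) :
    (∃ m : ℝ, 0 < m ∧ ∀ Ψ : S → Matrix n n ℂ, m * trIP w Ψ Ψ ≤ trIP w Ψ (T Ψ)) ↔
      (PosDefTr w T ∧ ∃ B : ℝ, 0 < B ∧ ∀ Φ : S → Matrix n n ℂ, trIP w Φ (Ring.inverse T Φ) ≤ B * trIP w Φ Φ) := by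
  constructor
  · rintro ⟨m, hm, hco⟩
    exact ⟨posDefTr_of_coer hw hm hco, m⁻¹, inv_pos.mpr hm, ringInverse_formBound_of_coer hw hm hco⟩
  · rintro ⟨hpd, B, hB, hform⟩
    exact ⟨B⁻¹, inv_pos.mpr hB, coer_of_isSymmTr_posDefTr_of_ringInverse_formBound hw hsym hpd hB hform⟩

end Trace

/-! ## §2. At NODE 00's bond sector, v4 letters: the interface for print's last inverse as one equivalence -/

section Bond

variable {d ℓ : ℕ} {hd : 1 ≤ d + 1} {hL : Odd (ℓ + 1) ∧ 1 < ℓ + 1} {b₀ b₁ : ℝ}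
variable (i : KIdx d ℓ hd hL b₀ b₁) {N : ℕ} {G : Subgroup (Matrix (Fin N) (Fin N) ℂ)ˣ}

/-- **THE LOCATED «⟹» FOR `Δ_a ∕ G`** (ANY letters `parS parB Gp`, ANY background `U₀`; no symmetry needed): an `m`-coercive `Δ_a(U₀)` (`0 < m`) has `G(U₀) = Δ_a(U₀)⁻¹` with the
form bound `⟨Φ, G(U₀)Φ⟩₁ ≤ m⁻¹·⟨Φ,Φ⟩₁` (`G = GAY … = Ring.inverse Δ_a` by NODE 00's definition).
[cite: Balaban1985BackgroundPropagators, (3.26)–(3.27) p.395, Thm 3.3 p.399, Thm 3.11 p.416; Balaban1984PropagatorsII, p.226] -/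
theorem GAY_formBound_of_coer (parS : SiteParY (Matrix (Fin N) (Fin N) ℂ) i) (parB : BondParY (Matrix (Fin N) (Fin N) ℂ) i)
    (Gp : SiteOpY (Matrix (Fin N) (Fin N) ℂ) i) (U₀ : CfgY (Matrix (Fin N) (Fin N) ℂ) i) {m : ℝ} (hm : 0 < m)
    (hco : ∀ Ψ : FBondY i → Matrix (Fin N) (Fin N) ℂ,
      m * trIP (fun _ => (1 : ℝ)) Ψ Ψ ≤ trIP (fun _ => (1 : ℝ)) Ψ (deltaAY i parS parB Gp U₀ Ψ))
    (Φ : FBondY i → Matrix (Fin N) (Fin N) ℂ) :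
    trIP (fun _ => (1 : ℝ)) Φ (GAY i parS parB Gp U₀ Φ) ≤ m⁻¹ * trIP (fun _ => (1 : ℝ)) Φ Φ :=
  ringInverse_formBound_of_coer (fun _ => one_pos) hm hco Φ

/-- ★★ **THE N10 ∕ N06 INTERFACE FOR THE LAST INVERSE AS ONE EQUIVALENCE** (v4 letters `parSymY ∕ parBY ∕ G′ = GpY parSymY`, fibre `M_N(ℂ)`, `G ≤ U(N)`, `G`-valued `U₀`):
`(∃ m > 0, ∀ Ψ, m⟨Ψ,Ψ⟩₁ ≤ ⟨Ψ, Δ_a(U₀)Ψ⟩₁) ↔ (PosDefTr 1 (Δ_a(U₀)) ∧ ∃ B > 0, ∀ Φ, ⟨Φ, G(U₀)Φ⟩₁ ≤ B⟨Φ,Φ⟩₁)` — the lane's quantitative `hco` on the left, Theorem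
3.11's clause (row 17) and Theorem 3.3's global L²-form bound for `G` on the right; symmetry of `Δ_a(U₀)` by the N06 lineage's `deltaAY_parSymY_isSymmTr`.
[cite: Balaban1985BackgroundPropagators, (3.26)–(3.27) p.395, (3.46)–(3.47) p.398, Thm 3.3 p.399, Thm 3.11 p.416; Balaban1984PropagatorsII, p.226] -/
theorem trIP_deltaAY_parSymY_coer_iff_posDefTr_and_GAY_formBound (hG : G ≤ B7Prop2Explicit.unitaryUnits (Matrix (Fin N) (Fin N) ℂ))
    {U₀ : CfgY (Matrix (Fin N) (Fin N) ℂ) i} (hU : ∀ μ x, U₀ μ x ∈ G) :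
    (∃ m : ℝ, 0 < m ∧ ∀ Ψ : FBondY i → Matrix (Fin N) (Fin N) ℂ,
        m * trIP (fun _ => (1 : ℝ)) Ψ Ψ ≤ trIP (fun _ => (1 : ℝ)) Ψ (deltaAY i (parSymY i) (parBY i) (GpY i (parSymY i)) U₀ Ψ)) ↔
      (PosDefTr (fun _ => (1 : ℝ)) (deltaAY i (parSymY i) (parBY i) (GpY i (parSymY i)) U₀) ∧
        ∃ B : ℝ, 0 < B ∧ ∀ Φ : FBondY i → Matrix (Fin N) (Fin N) ℂ,
          trIP (fun _ => (1 : ℝ)) Φ (GAY i (parSymY i) (parBY i) (GpY i (parSymY i)) U₀ Φ) ≤ B * trIP (fun _ => (1 : ℝ)) Φ Φ) :=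
  coer_iff_posDefTr_and_ringInverse_formBound (fun _ => one_pos) (deltaAY_parSymY_isSymmTr i hG hU)

end Bond

end Literature.MathematicalPhysics.QuantumFieldTheory.Balaban1983to89.B13CoerciveIffPosDefInverseBound

end
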